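import Summits.CriticalPhenomena.PercolationContinuityZ3.Theorems.PercNearOneGluingNoHeavyLowerTailThreePartitionCubeTables
import Summits.CriticalPhenomena.PercolationContinuityZ3.Theorems.PercNearOneGluingNoHeavyLowerTailThreePartitionCubeSymA

/-!
# Twisted three-partition positivity (★★) = (M⁺-3) on SIX letters: soundness of the checker, VI — **the enumeration visits every antichain**

Support file (cell `prim-sahi`, seat `prim-sahi-typer` gen 34; `--supports stmt-CriticalPhenomena-4575`).  Pure proofs plus bookkeeping definitions
(`nodeList`, `ptsOf`, `rootList`; the running keys `keysOf` are in `…CubeSymA`); no `sorry`, standard axioms.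
* `nodeList` — the list of nodes `(pts, S)` visited by `walk` (same recursion), and **`walk_eq_foldl`**: `walk` is the left fold of `nodeStep` over it
  (`nodeStep`, `nodeColourings`, `colourStep` send `none` to `none`);
* **`mem_nodeList`** — COMPLETENESS: every nonempty increasing list `Q` of candidate codes that is an antichain for `⊆` appears as the node
  `(pts ++ Q, keys)` in `nodeList T fuel pts S cand`, provided `fuel + lowBit cand ≥ 2^m` … precisely `2^m ≤ fuel + (least element of Q)`.
The threading of the batches through the fold (every pushed pair is eventually tested) and the first-point level `rootWalk` are in the companion
file `…CubeCover`. [this work]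
-/

namespace Summit.CriticalPhenomena.PercolationContinuityZ3.Theorems.ThreePartition.Cube

open SahiGridPattern.Pair43

/-! ### `none` is absorbing -/

/-- `colourStep` on `none`. [this work] -/
theorem colourStep_none (T : Tabs) (pts K : Array ℕ) (cb upN dF mm : ℕ) : colourStep T pts K cb upN dF mm none = none := rfl

/-- `nodeColourings` on `none`. [this work] -/
theorem nodeColourings_none (T : Tabs) (pts K : Array ℕ) : nodeColourings T pts K none = none := by
  unfold nodeColourings
  simp only []
  generalize (1 <<< (pts.size - 1)) = n
  induction n with
  | zero => rfl
  | succ n ih => show colourStep T pts K _ _ _ n (foldBelow n _ none) = none; rw [ih]; rfl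

/-- `nodeStep` on `none`. [this work] -/
theorem nodeStep_none (T : Tabs) (M r : ℕ) (pts S : Array ℕ) : nodeStep T M r pts S none = none := by
  unfold nodeStep
  dsimp only
  rw [nodeColourings_none]
  repeat' split
  all_goals rfl

/-- `walk` on `none`. [this work] -/
theorem walk_none (T : Tabs) (M r : ℕ) : ∀ (fuel : ℕ) (pts S : Array ℕ) (cand : ℕ), walk T M r fuel pts S cand none = none
  | 0, _, _, _ => rfl
  | _ + 1, _, _, _ => rfl

/-! ### The node list and the fold -/

/-- The nodes `(pts, S)` visited by `walk T M r fuel pts S cand`, in visiting order. [this work] -/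
def nodeList (T : Tabs) : ℕ → Array ℕ → Array ℕ → ℕ → List (Array ℕ × Array ℕ)
  | 0, _, _, _ => []
  | fuel + 1, pts, S, cand =>
    if cand = 0 then []
    else
      (pts.push (lowBit cand), sAdd T S (lowBit cand)) ::
        (nodeList T fuel (pts.push (lowBit cand)) (sAdd T S (lowBit cand)) (cand &&& T.nextT.getD (lowBit cand) 0) ++
          nodeList T fuel pts S (cand ^^^ (1 <<< lowBit cand)))

/-- A fold of `nodeStep` from `none` stays `none`. [this work] -/
theorem foldl_nodeStep_none (T : Tabs) (M r : ℕ) (l : List (Array ℕ × Array ℕ)) :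
    l.foldl (fun ob nd => nodeStep T M r nd.1 nd.2 ob) none = none := by
  induction l with
  | nil => rfl
  | cons nd l ih => rw [List.foldl_cons, nodeStep_none]; exact ih

/-- **`walk` is the left fold of `nodeStep` over `nodeList`.** [this work] -/
theorem walk_eq_foldl (T : Tabs) (M r : ℕ) : ∀ (fuel : ℕ) (pts S : Array ℕ) (cand : ℕ) (ob : Option Batch),
    walk T M r fuel pts S cand ob = (nodeList T fuel pts S cand).foldl (fun ob nd => nodeStep T M r nd.1 nd.2 ob) ob
  | 0, pts, S, cand, ob => by cases ob <;> rfl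
  | fuel + 1, pts, S, cand, ob => by
    cases ob with
    | none => rw [walk_none, foldl_nodeStep_none]
    | some b =>
      unfold walk nodeList
      by_cases hc : cand = 0
      · simp [hc]
      · simp only [hc, if_false, List.foldl_cons, List.foldl_append]
        rw [walk_eq_foldl T M r fuel, walk_eq_foldl T M r fuel]

/-! ### Completeness -/

/-- The point array of a node reached by appending the points of `Q`. [this work] -/
def ptsOf (pts : Array ℕ) (Q : List ℕ) : Array ℕ := Q.foldl Array.push pts

/-- A code set in a mask below `2^n` is `< n`. [this work] -/
theorem lt_of_testBit {c n q : ℕ} (hc : c < 2 ^ n) (hq : c.testBit q = true) : q < n := by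
  by_contra h
  rw [Nat.testBit_lt_two_pow (lt_of_lt_of_le hc (Nat.pow_le_pow_right (by norm_num) (not_lt.1 h)))] at hq
  exact Bool.false_ne_true hq

/-- **COMPLETENESS OF THE ENUMERATION.**  Let `cand < 2^(2^m)` and let `Q` be a nonempty strictly increasing list of codes set in `cand`, pairwise
incomparable for `⊆`.  If `2^m ≤ fuel + y` for every code `y` set in `cand`, then the node obtained from `(pts, S)` by appending the points of `Q`
belongs to `nodeList (mkTabs m) fuel pts S cand`. [this work] -/
theorem mem_nodeList (m : ℕ) : ∀ (fuel : ℕ) (pts S : Array ℕ) (cand : ℕ) (Q : List ℕ),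
    cand < 2 ^ (2 ^ m) → Q ≠ [] → Q.Pairwise (· < ·) → (∀ q ∈ Q, cand.testBit q = true) →
    (∀ q ∈ Q, ∀ q' ∈ Q, q ≠ q' → sub q q' = false) → (∀ y, cand.testBit y = true → 2 ^ m ≤ fuel + y) →
    (ptsOf pts Q, keysOf (mkTabs m) S Q) ∈ nodeList (mkTabs m) fuel pts S cand
  | 0, pts, S, cand, Q, hc, hQ, _, hin, _, hfuel => by
    -- fuel 0: `2^m ≤ q` contradicts `q < 2^m`
    obtain ⟨q, hq⟩ := List.exists_mem_of_ne_nil Q hQ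
    have h1 := hfuel q (hin q hq)
    have h2 : q < 2 ^ m := lt_of_testBit hc (hin q hq)
    omega
  | fuel + 1, pts, S, cand, Q, hc, hQ, hch, hin, hanti, hfuel => by
    obtain ⟨q₀, Q', rfl⟩ := List.exists_cons_of_ne_nil hQ
    have hc0 : cand ≠ 0 := by
      intro h; have h' := hin q₀ (by simp); rw [h, Nat.zero_testBit] at h'; exact Bool.false_ne_true h'
    obtain ⟨hxbit, hxmin⟩ : cand.testBit (lowBit cand) = true ∧ ∀ y < lowBit cand, cand.testBit y = false := by
      rw [lowBit_eq_pair43]; exact lowBit_spec hc0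
    have hxlt : lowBit cand < 2 ^ m := lowBit_lt hc0 hc
    have hq₀bit : cand.testBit q₀ = true := hin q₀ (by simp)
    -- every set bit of `cand` is `≥ lowBit cand`
    have hge : ∀ y, cand.testBit y = true → lowBit cand ≤ y := fun y hy => by
      by_contra h; have h' := hxmin y (not_le.1 h); rw [hy] at h'; exact Bool.noConfusion h'
    have hxle : lowBit cand ≤ q₀ := hge q₀ hq₀bit
    have hL := hfuel (lowBit cand) hxbit
    -- all other elements of `Q` are larger than `q₀`
    have hQ'gt : ∀ q ∈ Q', q₀ < q := (List.pairwise_cons.1 hch).1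
    have hch' : Q'.Pairwise (· < ·) := (List.pairwise_cons.1 hch).2
    unfold nodeList
    rw [if_neg hc0]
    by_cases hq0 : q₀ = lowBit cand
    · -- `q₀` is the lowest candidate: the node is the head or lies in the subtree of `q₀`
      rw [← hq0]
      by_cases hQ' : Q' = []
      · subst hQ'; exact List.mem_cons_self
      · refine List.mem_cons_of_mem _ (List.mem_append_left _ ?_)
        have hnext : ∀ y, (cand &&& (mkTabs m).nextT.getD q₀ 0).testBit y = true → cand.testBit y = true ∧ q₀ < y := by
          intro y hy
          rw [Nat.testBit_land, Bool.and_eq_true, testBit_nextT m (hq0 ▸ hxlt)] at hy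
          simp only [Bool.and_eq_true, decide_eq_true_eq] at hy
          exact ⟨hy.1, hy.2.2.1.1⟩
        have hsub : ∀ q ∈ Q', (cand &&& (mkTabs m).nextT.getD q₀ 0).testBit q = true := by
          intro q hq
          have hqlt : q < 2 ^ m := lt_of_testBit hc (hin q (List.mem_cons_of_mem _ hq))
          have hne : q₀ ≠ q := ne_of_lt (hQ'gt q hq)
          rw [Nat.testBit_land, hin q (List.mem_cons_of_mem _ hq), testBit_nextT m (hq0 ▸ hxlt), Bool.true_and]
          simp only [hqlt, decide_true, hQ'gt q hq, Bool.true_and, Bool.and_eq_true, Bool.not_eq_true']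
          exact ⟨hanti q (List.mem_cons_of_mem _ hq) _ (by simp) hne.symm, hanti _ (by simp) q (List.mem_cons_of_mem _ hq) hne⟩
        exact mem_nodeList m fuel (pts.push q₀) (sAdd (mkTabs m) S q₀) _ Q'
          (lt_of_le_of_lt Nat.and_le_left hc) hQ' hch' hsub
          (fun q hq q' hq' hne => hanti q (List.mem_cons_of_mem _ hq) q' (List.mem_cons_of_mem _ hq') hne)
          (fun y hy => by have h2 := (hnext y hy).2; rw [hq0] at h2; omega)
    · -- `q₀ > lowBit cand`: everything lies in the sibling continuation
      have hxq : lowBit cand < q₀ := lt_of_le_of_ne hxle (Ne.symm hq0)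
      refine List.mem_cons_of_mem _ (List.mem_append_right _ ?_)
      have hbit : ∀ y, (cand ^^^ (1 <<< lowBit cand)).testBit y = (cand.testBit y && decide (lowBit cand ≠ y)) := by
        intro y
        rw [Nat.testBit_xor, Nat.one_shiftLeft, Nat.testBit_two_pow]
        by_cases h : lowBit cand = y
        · subst h; simp [hxbit]
        · simp [h]
      have hsub : ∀ q ∈ q₀ :: Q', (cand ^^^ (1 <<< lowBit cand)).testBit q = true := by
        intro q hq
        have hxq' : lowBit cand ≠ q := by
          rcases List.mem_cons.1 hq with rfl | hq
          · exact ne_of_lt hxq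
          · exact ne_of_lt (hxq.trans (hQ'gt q hq))
        rw [hbit, hin q hq]
        simp [hxq']
      have hclt : cand ^^^ (1 <<< lowBit cand) < 2 ^ (2 ^ m) :=
        Nat.xor_lt_two_pow hc (by rw [Nat.one_shiftLeft]; exact Nat.pow_lt_pow_right (by norm_num) hxlt)
      exact mem_nodeList m fuel pts S _ (q₀ :: Q') hclt (List.cons_ne_nil _ _) hch hsub hanti
        (fun y hy => by
          rw [hbit, Bool.and_eq_true, decide_eq_true_eq] at hy
          have h1 := hge y hy.1
          have h2 := hy.2
          omega)

/-! ### The first-point level -/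

/-- The nodes visited by `rootWalk T sel M r fuel x`: for each first point `x' ≥ x` selected by `sel`, the node `{x'}` followed by its subtree.
[this work] -/
def rootList (T : Tabs) (sel : ℕ) : ℕ → ℕ → List (Array ℕ × Array ℕ)
  | 0, _ => []
  | fuel + 1, x =>
    if T.np ≤ x then []
    else
      (if sel.testBit x then (#[x], sAdd T (zeros T) x) :: nodeList T (T.np + 1) #[x] (sAdd T (zeros T) x) (T.nextT.getD x 0) else []) ++
        rootList T sel fuel (x + 1)

/-- `rootWalk` on `none`. [this work] -/
theorem rootWalk_none (T : Tabs) (sel M r : ℕ) : ∀ (fuel x : ℕ), rootWalk T sel M r fuel x none = none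
  | 0, _ => rfl
  | _ + 1, _ => rfl

/-- **`rootWalk` is the left fold of `nodeStep` over `rootList`.** [this work] -/
theorem rootWalk_eq_foldl (T : Tabs) (sel M r : ℕ) : ∀ (fuel x : ℕ) (ob : Option Batch),
    rootWalk T sel M r fuel x ob = (rootList T sel fuel x).foldl (fun ob nd => nodeStep T M r nd.1 nd.2 ob) ob
  | 0, x, ob => by cases ob <;> rfl
  | fuel + 1, x, ob => by
    cases ob with
    | none => rw [rootWalk_none, foldl_nodeStep_none]
    | some b =>
      unfold rootWalk rootList
      by_cases hx : T.np ≤ x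
      · simp [hx]
      · simp only [hx, if_false, List.foldl_append]
        rw [rootWalk_eq_foldl T sel M r fuel (x + 1)]
        congr 1
        by_cases hs : sel.testBit x = true
        · simp only [hs, if_true, List.foldl_cons]
          rw [walk_eq_foldl]; rfl
        · simp [hs]

/-- **COMPLETENESS AT THE FIRST-POINT LEVEL.**  Every nonempty increasing antichain `Q` of codes `< 2^m` whose least element is selected by `sel`
and is `≥ x` appears in `rootList (mkTabs m) sel fuel x` whenever `2^m ≤ fuel + x`. [this work] -/
theorem mem_rootList (m sel : ℕ) : ∀ (fuel x : ℕ) (q₀ : ℕ) (Q' : List ℕ),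
    (q₀ :: Q').Pairwise (· < ·) → (∀ q ∈ q₀ :: Q', q < 2 ^ m) → (∀ q ∈ q₀ :: Q', ∀ q' ∈ q₀ :: Q', q ≠ q' → sub q q' = false) →
    sel.testBit q₀ = true → x ≤ q₀ → 2 ^ m ≤ fuel + x →
    (ptsOf #[] (q₀ :: Q'), keysOf (mkTabs m) (zeros (mkTabs m)) (q₀ :: Q')) ∈ rootList (mkTabs m) sel fuel x
  | 0, x, q₀, Q', _, hlt, _, _, hx, hfuel => by have h1 := hlt q₀ (by simp); omega
  | fuel + 1, x, q₀, Q', hch, hlt, hanti, hsel, hx, hfuel => by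
    have hq₀ : q₀ < 2 ^ m := hlt q₀ (by simp)
    have hQ'gt : ∀ q ∈ Q', q₀ < q := (List.pairwise_cons.1 hch).1
    have hch' : Q'.Pairwise (· < ·) := (List.pairwise_cons.1 hch).2
    unfold rootList
    rw [if_neg (by rw [np_eq]; omega)]
    by_cases hxq : x = q₀
    · subst hxq
      refine List.mem_append_left _ ?_
      rw [if_pos hsel]
      by_cases hQ' : Q' = []
      · subst hQ'; exact List.mem_cons_self
      · refine List.mem_cons_of_mem _ ?_
        have hsub : ∀ q ∈ Q', ((mkTabs m).nextT.getD x 0).testBit q = true := by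
          intro q hq
          have hne : x ≠ q := ne_of_lt (hQ'gt q hq)
          rw [testBit_nextT m hq₀]
          simp only [hlt q (List.mem_cons_of_mem _ hq), decide_true, hQ'gt q hq, Bool.true_and, Bool.and_eq_true, Bool.not_eq_true']
          exact ⟨hanti q (List.mem_cons_of_mem _ hq) _ (by simp) hne.symm, hanti _ (by simp) q (List.mem_cons_of_mem _ hq) hne⟩
        have hclt : (mkTabs m).nextT.getD x 0 < 2 ^ (2 ^ m) := by
          have h1 : (mkTabs m).nextT = Array.ofFn fun a : Fin (1 <<< m) =>
              maskOfN (1 <<< m) fun b => decide (a.val < b) && !(sub b a) && !(sub a b) := rfl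
          have hx' : x < 1 <<< m := by rw [Nat.one_shiftLeft]; exact hq₀
          rw [h1, Array.getD_eq_getD_getElem?, Array.getElem?_ofFn]
          simp only [hx', dif_pos, Option.getD_some]
          have h2 := maskOfN_lt (1 <<< m) (fun b => decide (x < b) && !(sub b x) && !(sub x b))
          have h3 : (2 : ℕ) ^ (1 <<< m) = 2 ^ (2 ^ m) := by rw [Nat.one_shiftLeft]
          exact h3 ▸ h2
        exact mem_nodeList m ((mkTabs m).np + 1) #[x] (sAdd (mkTabs m) (zeros (mkTabs m)) x) _ Q' hclt hQ' hch' hsub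
          (fun q hq q' hq' hne => hanti q (List.mem_cons_of_mem _ hq) q' (List.mem_cons_of_mem _ hq') hne)
          (fun y hy => by have h1 := lt_of_testBit hclt hy; rw [np_eq]; omega)
    · refine List.mem_append_right _ ?_
      exact mem_rootList m sel fuel (x + 1) q₀ Q' hch hlt hanti hsel (by omega) (by omega)

/-- The node of the antichain `Q`, as it is reached from the root. [this work] -/
theorem ptsOf_nil_eq (Q : List ℕ) : ptsOf #[] Q = Q.toArray := by
  unfold ptsOf
  have : ∀ (pts : Array ℕ), Q.foldl Array.push pts = pts ++ Q.toArray := by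
    induction Q with
    | nil => intro pts; simp
    | cons a Q ih => intro pts; rw [List.foldl_cons, ih]; simp
  rw [this]; simp

end Summit.CriticalPhenomena.PercolationContinuityZ3.Theorems.ThreePartition.Cube
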